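import Summits.ResolutionOfSingularities.ResolutionOfSingularities.Theorems.WildConesCampaignW46ForcedAtomExists
import Summits.ResolutionOfSingularities.ResolutionOfSingularities.Theorems.MarkedTransferCampaignW46MohWindowSurfaceInstance
import Summits.ResolutionOfSingularities.ResolutionOfSingularities.Theorems.MarkedTransferCampaignW46MohWindowSurfaceFormalCoordinates
import Literature.AlgebraicGeometry.Resolution.AlterationsFormalCoordinates
import Literature.AlgebraicGeometry.Resolution.OriginLocalRing
import HarnessLib

/-!
# [OURS · L1 W4.6, rung (i), embedded surfaces in 3-space] KERNEL NON-VACUITY WITNESS for the forced-atom regime in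
# three variables: the purely inseparable surfaces `((z^p + x^d + y^d)·𝒪, p)`, `p < d`, `p ∤ d`, on affine 3-space lie in
# `CampaignW46.Regime.forcedAtom 2`
# (cell res-hironaka, LADDER-RESOLUTION rung L, D-0089; slot W4.6, seat res-L1-s46-pv-2 gen 3; host route `WildCones`,
# crux `ClassicalRegimes` stmt-ResolutionOfSingularities-16884, `--supports … --as helper`)

HONEST FRAMING. Everything here is OURS: kernel theorems about ONE explicit family of typed states, assembled from TREE
theorems — res-L1-s46-pv-13's scheme-level surface state on `𝔸³_K` (`CampaignW46.SurfacePlane.mem_sing_iff`,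
`sing_subsingleton`, `stalkIdeal_eq_span`, `maximalIdeal_stalk_origin`, `ringKrullDim_stalk_origin`,
`spanFinrank_maximalIdeal_stalk_origin`, `isStandard`, `sing_nonempty`; `Theorems/MarkedTransferCampaignW46MohWindowSurfaceInstance.lean`),
res-L1-s46-pv-3's ambient datum `CampaignW46.spaceAmbientDatum K p = (Spec K[x,y,z] → Spec K)` (`…ThreefoldsWitness.lean`),
the lane Lib `SpecOrders` (`St`, `shf`, `isLocSt`), Cohen's structure theorem with PRESCRIBED regular system of parameters
(`exists_ringEquiv_adicCompletion_mvPowerSeries_of_rsop`, [Matsumura1987] Thm. 29.7 with 28.3 (ii)), Mathlib's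
`IsLocalization.AtPrime.equivQuotMaximalIdeal`, and this seat's `Regime.forcedAtom_of_exists` (p520554) and brick 14
(`AtomGerm.finite_quotient_iff_exists_pow_le`). The manuscript enters only through the typed CANDIDATE carriers of row
001 and the OURS regime of res-L1-type-o1 (p517839); NOTHING here is a statement of H. Hironaka's manuscript
[Hironaka2017]; no FACT-LIST premise. AI review is weaker than expert review.

## What is proved (the «embedded surface in 3-space» instance of the forced-atom rung; companion of
## `…ForcedAtomWitness.lean`, the plane-curve instance)

* §1 coefficient level, TWO variables `u₀, u₁`: for a series `F` none of whose monomials is a `p`-th power, the state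
  `A ↦ coeff_A F` has `ser = F` (`ser_coeff_eq`); in `K⟦u₀,u₁⟧`, `𝔪^{a+b} ≤ (u₀^a, u₁^b)` (`maximalIdeal_pow_le_span_pair`);
  the state of `F_d = −(u₀^d + u₁^d)`, `p ∤ d`, is ISOLATED (`isol_negFermat`: its gradient ideal contains
  `(u₀^{d−1}, u₁^{d−1}) ⊇ 𝔪^{2d−2}`).
* §2 the origin of `𝔸³_K`: `𝒪̂_{𝔸³,0} ≃+* K⟦z,u₀,u₁⟧` with `x ↦ u₀ = X (some 0)`, `y ↦ u₁ = X (some 1)`, `z ↦ X none`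
  (`exists_presentation_origin`).
* §3 `CampaignW46.SurfacePlane.regime_forcedAtom`: for every PERFECT field `K` of characteristic `p` and every `d` with
  `p < d`, `p ∤ d`, the standard state `E_d = ((z^p + x^d + y^d)·𝒪, p)` on `𝔸³_K` lies in `Regime.forcedAtom 2`;
  `exists_singular_state_forcedAtom_two` (the regime contains a STANDARD state with NON-EMPTY singular locus, `d = p+1`);
  `forcedAtomTerminates_two_and_inhabited`: over an algebraically closed `K`, o1's rung `ForcedAtomTerminates p K 2`
  (SURFACES `z^p = a(x,y)` in 3-space; closed by this seat's p516034) HOLDS on an inhabited, honestly singular regime.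

References: res-L1-s46-pv-13 (MohWindowSurfaceInstance), res-L1-s46-pv-3 (ThreefoldsWitness), this seat's p516034 /
p517877 / p520554, res-L1-type-o1 p517839. [cite: Matsumura1987, Thm. 29.7] [folklore]
-/

noncomputable section

-- single-problem summit: the doubled namespace component `ResolutionOfSingularities` is forced
set_option linter.dupNamespace false

open scoped BigOperators Classical
open MvPowerSeries IsLocalRing
open CategoryTheory AlgebraicGeometry TopologicalSpace

namespace Summit.ResolutionOfSingularities.ResolutionOfSingularities.Theorems

namespace CampaignW46.SurfacePlane

open Literature.AlgebraicGeometry.Resolution Scheme.IdealSheafData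
open Literature.AlgebraicGeometry.Hironaka2017.S02Preliminaries
open Literature.AlgebraicGeometry.Hironaka2017.SpecOrders
open Literature.AlgebraicGeometry.Hironaka2017.Datum
open WildCones

variable (p : ℕ) (K : Type) [Field K]

/-! ## §1 Coefficient level: the two-variable state `−(u₀^d + u₁^d)` -/

/-- A series none of whose monomials has all exponents divisible by `p` is the cleaned series of its own coefficient
function. [folklore] -/
theorem ser_coeff_eq {n : ℕ} (F : MvPowerSeries (Fin n) K)
    (hF : ∀ A : Fin n →₀ ℕ, (∀ j, p ∣ A j) → MvPowerSeries.coeff A F = 0) :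
    ser p n K (fun A : Fin n → ℕ => MvPowerSeries.coeff (Finsupp.equivFunOnFinite.symm A) F) = F := by
  ext A
  change clean p n K (fun A : Fin n → ℕ => MvPowerSeries.coeff (Finsupp.equivFunOnFinite.symm A) F) ⇑A = _
  simp only [clean, Finsupp.equivFunOnFinite_symm_coe]
  split_ifs with h
  · exact (hF A h).symm
  · rfl

/-- The Fermat binomial `−(u₀^d + u₁^d)`, `p ∤ d`, has no monomial with all exponents divisible by `p`. [folklore] -/
theorem coeff_negFermat_eq_zero {d : ℕ} (hd : ¬ p ∣ d) (A : Fin 2 →₀ ℕ) (hA : ∀ j, p ∣ A j) :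
    MvPowerSeries.coeff A (-((MvPowerSeries.X 0 : MvPowerSeries (Fin 2) K) ^ d +
      (MvPowerSeries.X 1 : MvPowerSeries (Fin 2) K) ^ d)) = 0 := by
  have h0 : A ≠ Finsupp.single 0 d := fun h => hd (by simpa [h] using hA 0)
  have h1 : A ≠ Finsupp.single 1 d := fun h => hd (by simpa [h] using hA 1)
  rw [map_neg, map_add, coeff_X_pow, coeff_X_pow, if_neg h0, if_neg h1, add_zero, neg_zero]

/-- In two variables, `𝔪^{a+b} ≤ (u₀^a, u₁^b)` in `K⟦u₀,u₁⟧`: a series of order `≥ a + b` splits as `u₀^a·g + u₁^b·h`.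
[folklore] -/
theorem maximalIdeal_pow_le_span_pair (a b : ℕ) :
    maximalIdeal (MvPowerSeries (Fin 2) K) ^ (a + b) ≤
      Ideal.span {(MvPowerSeries.X 0 : MvPowerSeries (Fin 2) K) ^ a,
        (MvPowerSeries.X 1 : MvPowerSeries (Fin 2) K) ^ b} := by
  intro f hf
  have hord := Literature.RingTheory.MvPowerSeries.Jets.le_order_of_mem_maximalIdeal_pow hf
  -- the part of `f` divisible by `u₀^a`
  let f₁ : MvPowerSeries (Fin 2) K := fun m => if a ≤ m 0 then MvPowerSeries.coeff m f else 0
  have hf₁ : ∀ m, MvPowerSeries.coeff m f₁ = if a ≤ m 0 then MvPowerSeries.coeff m f else 0 := fun m => rfl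
  have hd₁ : (MvPowerSeries.X 0 : MvPowerSeries (Fin 2) K) ^ a ∣ f₁ := by
    rw [X_pow_dvd_iff]
    intro m hm
    rw [hf₁, if_neg (not_le.mpr hm)]
  have hd₂ : (MvPowerSeries.X 1 : MvPowerSeries (Fin 2) K) ^ b ∣ f - f₁ := by
    rw [X_pow_dvd_iff]
    intro m hm
    rw [map_sub, hf₁]
    by_cases h0 : a ≤ m 0
    · rw [if_pos h0, sub_self]
    · rw [if_neg h0, sub_zero]
      apply coeff_of_lt_order
      refine lt_of_lt_of_le ?_ hord
      have hdeg : m.degree = m 0 + m 1 := by rw [Finsupp.degree_eq_sum, Fin.sum_univ_two]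
      exact_mod_cast (show m.degree < a + b by rw [hdeg]; omega)
  obtain ⟨g₁, hg₁⟩ := hd₁
  obtain ⟨g₂, hg₂⟩ := hd₂
  rw [Ideal.mem_span_pair]
  exact ⟨g₁, g₂, by rw [mul_comm g₁, mul_comm g₂, ← hg₁, ← hg₂, add_sub_cancel]⟩

/-- The state of `−(u₀^d + u₁^d)` (`p ∤ d`) is ISOLATED: its gradient ideal `(d u₀^{d−1}, d u₁^{d−1})` contains
`𝔪^{2(d−1)}`, so the Milnor algebra is finite over `K`. [folklore] -/
theorem isol_negFermat [CharP K p] {d : ℕ} (hd : ¬ p ∣ d) :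
    Isol p 2 K (fun A : Fin 2 → ℕ => MvPowerSeries.coeff (Finsupp.equivFunOnFinite.symm A)
      (-((MvPowerSeries.X 0 : MvPowerSeries (Fin 2) K) ^ d + (MvPowerSeries.X 1 : MvPowerSeries (Fin 2) K) ^ d))) := by
  have hd0 : d ≠ 0 := by
    rintro rfl
    exact hd (dvd_zero p)
  obtain ⟨m, rfl⟩ : ∃ m, d = m + 1 := ⟨d - 1, by omega⟩
  set F : MvPowerSeries (Fin 2) K := -((MvPowerSeries.X 0 : MvPowerSeries (Fin 2) K) ^ (m + 1) +
    (MvPowerSeries.X 1 : MvPowerSeries (Fin 2) K) ^ (m + 1)) with hFdef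
  have hser : ser p 2 K (fun A : Fin 2 → ℕ => MvPowerSeries.coeff (Finsupp.equivFunOnFinite.symm A) F) = F :=
    ser_coeff_eq p K F (coeff_negFermat_eq_zero p K hd)
  -- the unit `d = m + 1` of `K⟦u⟧`
  have hunit : IsUnit (((m + 1 : ℕ) : MvPowerSeries (Fin 2) K)) := by
    rw [← map_natCast (MvPowerSeries.C (σ := Fin 2) (R := K))]
    refine IsUnit.map _ (isUnit_iff_ne_zero.mpr fun h => hd ?_)
    exact (CharP.cast_eq_zero_iff K p (m + 1)).mp h
  obtain ⟨u, hu⟩ := hunit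
  -- the two partial derivatives
  have hpd : ∀ i : Fin 2, WildCones.pd 2 K i F =
      -(((m + 1 : ℕ) : MvPowerSeries (Fin 2) K) * (MvPowerSeries.X i : MvPowerSeries (Fin 2) K) ^ m) := by
    intro i
    rw [AtomGerm.pd_eq_pd, hFdef, map_neg, map_add, Literature.RingTheory.MvPowerSeries.pd_pow_succ,
      Literature.RingTheory.MvPowerSeries.pd_pow_succ, Literature.RingTheory.MvPowerSeries.pd_X,
      Literature.RingTheory.MvPowerSeries.pd_X]
    fin_cases i
    · simp
    · simp
  -- the gradient ideal contains `(u₀^m, u₁^m)`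
  have hle : Ideal.span {(MvPowerSeries.X 0 : MvPowerSeries (Fin 2) K) ^ m,
      (MvPowerSeries.X 1 : MvPowerSeries (Fin 2) K) ^ m} ≤
      jac p 2 K (fun A : Fin 2 → ℕ => MvPowerSeries.coeff (Finsupp.equivFunOnFinite.symm A) F) := by
    change _ ≤ Ideal.span (Set.range fun i : Fin 2 =>
      WildCones.pd 2 K i (ser p 2 K (fun A : Fin 2 → ℕ => MvPowerSeries.coeff (Finsupp.equivFunOnFinite.symm A) F)))
    rw [hser, Ideal.span_le]
    have hgen : ∀ i : Fin 2, (MvPowerSeries.X i : MvPowerSeries (Fin 2) K) ^ m ∈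
        Ideal.span (Set.range fun i : Fin 2 => WildCones.pd 2 K i F) := by
      intro i
      have hmem : WildCones.pd 2 K i F ∈ Ideal.span (Set.range fun i : Fin 2 => WildCones.pd 2 K i F) :=
        Ideal.subset_span ⟨i, rfl⟩
      rw [hpd i, ← hu] at hmem
      have h2 := Ideal.mul_mem_left _ (↑u⁻¹ : MvPowerSeries (Fin 2) K) ((Ideal.neg_mem_iff _).mp hmem)
      rwa [← mul_assoc, Units.inv_mul, one_mul] at h2
    rintro g hg
    simp only [Set.mem_insert_iff, Set.mem_singleton_iff] at hg
    rcases hg with rfl | rfl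
    · exact hgen 0
    · exact hgen 1
  change Module.Finite K (MvPowerSeries (Fin 2) K ⧸
    jac p 2 K (fun A : Fin 2 → ℕ => MvPowerSeries.coeff (Finsupp.equivFunOnFinite.symm A) F))
  rw [AtomGerm.finite_quotient_iff_exists_pow_le]
  exact ⟨m + m, (maximalIdeal_pow_le_span_pair K m m).trans hle⟩

/-! ## §2 The origin of affine 3-space in Cohen coordinates -/

/-- **Formal coordinates at the origin of `𝔸³_K`, with coefficients in `K`**: a ring isomorphism
`𝒪̂_{𝔸³,0} ≃+* K⟦z,u₀,u₁⟧` with `x ↦ u₀ = X (some 0)`, `y ↦ u₁ = X (some 1)`, `z ↦ X none` (Cohen's structure theorem with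
the prescribed regular system of parameters `(x, y, z)`; the residue field of the `K`-rational origin is `K`).
[cite: Matsumura1987, Thm. 29.7] -/
theorem exists_presentation_origin [Fact p.Prime] [CharP K p] :
    ∃ E₀ : AdicCompletion (maximalIdeal (St (R3 K) ⟨originIdeal K 3, inferInstance⟩))
        (St (R3 K) ⟨originIdeal K 3, inferInstance⟩) ≃+* MvPowerSeries (Option (Fin 2)) K,
      E₀ (algebraMap _ _ (algebraMap (R3 K) (St (R3 K) ⟨originIdeal K 3, inferInstance⟩) (MvPolynomial.X 0))) =
          MvPowerSeries.X (some 0) ∧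
      E₀ (algebraMap _ _ (algebraMap (R3 K) (St (R3 K) ⟨originIdeal K 3, inferInstance⟩) (MvPolynomial.X 1))) =
          MvPowerSeries.X (some 1) ∧
      E₀ (algebraMap _ _ (algebraMap (R3 K) (St (R3 K) ⟨originIdeal K 3, inferInstance⟩) (MvPolynomial.X 2))) =
          MvPowerSeries.X none := by
  set x₀ : ZA3 K := ⟨originIdeal K 3, inferInstance⟩ with hx₀
  have hx : x₀.asIdeal = originIdeal K 3 := rfl
  haveI hreg : IsRegularLocalRing (St (R3 K) x₀) := isRegularLocalRing_stalk p K x₀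
  -- a field inside the stalk (the image of `K`)
  obtain ⟨k₀, hk₀⟩ := AmbientDatum.exists_isField_subring_stalk (spaceAmbientDatum K p) x₀
  -- the residue field of the origin is `K`
  haveI : IsLocalization.AtPrime (St (R3 K) x₀) (originIdeal K 3) := isLocSt (R3 K) x₀
  let ι : ResidueField (St (R3 K) x₀) ≃+* K :=
    (IsLocalization.AtPrime.equivQuotMaximalIdeal (originIdeal K 3) (St (R3 K) x₀)).symm.trans
      (RingHom.quotientKerEquivOfSurjective (Literature.AlgebraicGeometry.Resolution.constantCoeff_surjective K 3))
  -- the regular system of parameters `(x/1, y/1, z/1)`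
  let z : Fin 3 → St (R3 K) x₀ := fun i => algebraMap (R3 K) (St (R3 K) x₀) (MvPolynomial.X i)
  have hz : Ideal.span (Set.range z) = maximalIdeal (St (R3 K) x₀) := by
    rw [show maximalIdeal (St (R3 K) x₀) = maximalIdeal ((ZA3 K).presheaf.stalk x₀) from rfl,
      maximalIdeal_stalk_origin K hx, show z = (algebraMap (R3 K) (St (R3 K) x₀)) ∘ (MvPolynomial.X : Fin 3 → R3 K)
        from rfl, Set.range_comp, range_X_fin_three, Set.image_insert_eq, Set.image_insert_eq, Set.image_singleton]
  have hd : ringKrullDim (St (R3 K) x₀) = (3 : ℕ) := ringKrullDim_stalk_origin K hx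
  obtain ⟨e, he⟩ := @exists_ringEquiv_adicCompletion_mvPowerSeries_of_rsop (St (R3 K) x₀) _ hreg k₀ hk₀ K _ ι 3 z hz hd
  refine ⟨e.trans (renameEquiv K (finSuccEquivLast (n := 2))).toRingEquiv, ?_, ?_, ?_⟩
  · rw [RingEquiv.trans_apply, he 0]
    exact (rename_X (⇑(finSuccEquivLast (n := 2))) (0 : Fin 3) :
      rename (⇑(finSuccEquivLast (n := 2))) (MvPowerSeries.X 0 : MvPowerSeries (Fin 3) K) = _).trans
        (by rw [show (0 : Fin 3) = Fin.castSucc (0 : Fin 2) from rfl, finSuccEquivLast_castSucc])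
  · rw [RingEquiv.trans_apply, he 1]
    exact (rename_X (⇑(finSuccEquivLast (n := 2))) (1 : Fin 3) :
      rename (⇑(finSuccEquivLast (n := 2))) (MvPowerSeries.X 1 : MvPowerSeries (Fin 3) K) = _).trans
        (by rw [show (1 : Fin 3) = Fin.castSucc (1 : Fin 2) from rfl, finSuccEquivLast_castSucc])
  · rw [RingEquiv.trans_apply, he 2]
    exact (rename_X (⇑(finSuccEquivLast (n := 2))) (2 : Fin 3) :
      rename (⇑(finSuccEquivLast (n := 2))) (MvPowerSeries.X 2 : MvPowerSeries (Fin 3) K) = _).trans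
        (by rw [show (2 : Fin 3) = Fin.last 2 from rfl, finSuccEquivLast_last])

/-! ## §3 The purely inseparable surfaces lie in the forced-atom regime -/

/-- [OURS · L1 W4.6 rung (i), embedded surfaces in 3-space — NON-VACUITY WITNESS; NOT a statement of the manuscript]
**The standard state `E_d = ((z^p + x^d + y^d)·𝒪, p)` on `𝔸³_K` lies in `Regime.forcedAtom 2`** for every perfect field `K`
of characteristic `p` and every `d` with `p < d`, `p ∤ d`: its singular locus is the origin (res-L1-s46-pv-13), of
embedding dimension `3`, where `J_0 = ((z/1)^p + (x/1)^d + (y/1)^d)` is carried by the Cohen coordinates to the atom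
`z^p − (−(u₀^d + u₁^d))` of the ISOLATED two-variable state of route `WildCones`' calculus. [folklore] -/
theorem regime_forcedAtom [Fact p.Prime] [CharP K p] [PerfectRing K p] {d : ℕ} (hpd : p < d) (hd : ¬ p ∣ d) :
    Regime.forcedAtom (p := p) (K := K) 2 (spaceAmbientDatum K p)
      ⟨shf (R3 K) (Ideal.span {MvPolynomial.X 2 ^ p + MvPolynomial.X 0 ^ d + MvPolynomial.X 1 ^ d}), p⟩ := by
  refine Regime.forcedAtom_of_exists _ _ ⟨rfl, sing_subsingleton p K hpd hd, fun ξ hξ => ?_⟩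
  have hx : ξ.asIdeal = originIdeal K 3 := (mem_sing_iff p K hpd hd ξ).mp hξ
  obtain rfl : ξ = ⟨originIdeal K 3, inferInstance⟩ := PrimeSpectrum.ext hx
  -- the presentation, stated over the model `ZA3 K` (definitionally the ambient scheme of `spaceAmbientDatum K p`)
  have hpres : ∃ (E₀ : AdicCompletion (maximalIdeal (St (R3 K) ⟨originIdeal K 3, inferInstance⟩))
        (St (R3 K) ⟨originIdeal K 3, inferInstance⟩) ≃+* MvPowerSeries (Option (Fin 2)) K)
      (f₀ : St (R3 K) ⟨originIdeal K 3, inferInstance⟩) (c₀ : (Fin 2 → ℕ) → K) (w₀ : MvPowerSeries (Option (Fin 2)) K),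
      stalkIdeal (shf (R3 K) (Ideal.span {MvPolynomial.X 2 ^ p + MvPolynomial.X 0 ^ d + MvPolynomial.X 1 ^ d}))
          ⟨originIdeal K 3, inferInstance⟩ = Ideal.span {f₀} ∧ IsUnit w₀ ∧
        E₀ (algebraMap _ _ f₀) = w₀ * ((MvPowerSeries.X none : MvPowerSeries (Option (Fin 2)) K) ^ p -
          rename (some : Fin 2 → Option (Fin 2)) (ser p 2 K c₀)) ∧ Isol p 2 K c₀ := by
    obtain ⟨E₀, h0, h1, h2⟩ := exists_presentation_origin p K
    refine ⟨E₀, _, _, 1, stalkIdeal_eq_span p K d _, isUnit_one, ?_, isol_negFermat p K hd⟩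
    rw [ser_coeff_eq p K _ (coeff_negFermat_eq_zero p K hd)]
    simp only [map_add, map_pow, h0, h1, h2, map_neg, rename_X, one_mul, sub_neg_eq_add]
  have hdim : (maximalIdeal (St (R3 K) ⟨originIdeal K 3, inferInstance⟩)).spanFinrank = 2 + 1 :=
    spanFinrank_maximalIdeal_stalk_origin p K rfl
  exact ⟨hdim, hpres⟩

/-- [OURS · L1 W4.6 rung (i), embedded surfaces in 3-space — NON-VACUITY; NOT a statement of the manuscript] For every
prime `p` and every PERFECT field `K` of characteristic `p`, the forced-atom regime `Regime.forcedAtom 2` (surfaces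
`z^p = a(x,y)` in 3-space) contains a STANDARD state with NON-EMPTY singular locus (`((z^p + x^{p+1} + y^{p+1})·𝒪, p)`
on `𝔸³_K`). [folklore] -/
theorem exists_singular_state_forcedAtom_two [Fact p.Prime] [CharP K p] [PerfectRing K p] :
    ∃ (A : AmbientDatum p K) (E : IdealExponent A.Z),
      Regime.forcedAtom (p := p) (K := K) 2 A E ∧ E.IsStandard ∧ E.sing.Nonempty := by
  have hp : p.Prime := Fact.out
  have hn : ¬ p ∣ p + 1 := fun h => hp.one_lt.ne' (Nat.dvd_one.mp ((Nat.dvd_add_right (dvd_refl p)).mp h))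
  exact ⟨spaceAmbientDatum K p,
    ⟨shf (R3 K) (Ideal.span {MvPolynomial.X 2 ^ p + MvPolynomial.X 0 ^ (p + 1) + MvPolynomial.X 1 ^ (p + 1)}), p⟩,
    regime_forcedAtom p K (Nat.lt_succ_self p) hn, isStandard p K (Nat.lt_succ_self p),
    sing_nonempty p K (Nat.lt_succ_self p) hn⟩

/-- [OURS · L1 W4.6 rung (i), embedded surfaces in 3-space; NOT a statement of the manuscript] **The surface rung on an
inhabited regime.** Over an algebraically closed field `K` of characteristic `p`: o1's rung `ForcedAtomTerminates p K 2`
— the typed Th. 16.6 procedure has no infinite run inside the forced-atom regime of SURFACES `z^p = a(x,y)` in 3-space —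
HOLDS (closed by this seat's p516034 through `forcedAtomTerminates_holds`) AND that regime contains a standard state
with non-empty singular locus. [folklore] -/
theorem forcedAtomTerminates_two_and_inhabited [Fact p.Prime] [CharP K p] [IsAlgClosed K] :
    ForcedAtomTerminates p K 2 ∧
      ∃ (A : AmbientDatum p K) (E : IdealExponent A.Z),
        Regime.forcedAtom (p := p) (K := K) 2 A E ∧ E.IsStandard ∧ E.sing.Nonempty :=
  haveI : PerfectRing K p := PerfectField.toPerfectRing p
  ⟨forcedAtomTerminates_holds Nat.two_pos, exists_singular_state_forcedAtom_two p K⟩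

end CampaignW46.SurfacePlane

end Summit.ResolutionOfSingularities.ResolutionOfSingularities.Theorems

end
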